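import Summits.ResolutionOfSingularities.ResolutionOfSingularities.Theorems.FrobeniusLadderFInjectiveMacaulayficationToricChartFedder
import Summits.ResolutionOfSingularities.ResolutionOfSingularities.Theorems.FrobeniusLadderFInjectiveMacaulayficationQ6CNKit
import Mathlib.Algebra.MvPolynomial.PDeriv
import Mathlib.Algebra.CharP.Lemmas
import HarnessLib

/-!
# CI POLY KIT — polynomials as lists of (integer coefficient, exponent vector): `decide`-able identities modulo `p`
# (crux `FInjectiveMacaulayfication`, CI-CN engine, K-T4 Lean half; seat res-L1-w45a-stub-6 = res-D-pv-018)

Support file for crux stmt-ResolutionOfSingularities-15315. [OURS · L1 W4.5a] — NOT a statement of the manuscript; AI-written, weaker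
than expert review.

The smooth-face certificates of `CISmoothChart` / `CIOrbitExpectedDim` are polynomial identities in characteristic `p`
(`Y^e = Σ a_l g^S_l + Σ b_μ det_μ`). `decide` cannot evaluate `MvPolynomial` arithmetic (non-computable `Finsupp`), so — as in
`Q6CNKit` for monic monomial sums — a polynomial is written as a LIST of terms `(c, v) : ℤ × (Fin n → ℕ)` standing for
`Σ (c : K) · Y^v`, every operation the certificates need is an explicit LIST expression (`++`, `flatMap`/`map` products, termwise
`∂/∂Y_j`, `filter` for `Y_S ↦ 0`), and ONE soundness lemma per operation reduces the identity to a congruence of integer coefficient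
sums modulo `p`, decided by `decide` on the data. No definition is declared: the «value of a list» is written out each time as
`(L.map fun t => monomial (equivFunOnFinite.symm t.2) (t.1 : K)).sum`.

* `evalL_append`, `evalL_mul` (product list), `evalL_neg`, `pderiv_evalL`, `substZero_evalL`, `coeff_evalL`,
  `evalL_eq_of_coeff_congr` (two lists with coefficient sums congruent mod `p` at every listed exponent have equal values over any
  `K` of characteristic `p`), `theta_evalL` (the chart map on a list, termwise exponent identity).

[folklore]
-/

-- single-problem summit: the doubled namespace component is forced
set_option linter.dupNamespace false

noncomputable section

namespace Summit.ResolutionOfSingularities.ResolutionOfSingularities.Theorems.FInjectiveMacaulayfication.CIPolyKit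

open MvPolynomial
open Summit.ResolutionOfSingularities.ResolutionOfSingularities.Theorems.FInjectiveMacaulayfication

variable {K : Type} [CommRing K] {n : ℕ}

/-! ## §1 Values of term lists -/

/-- Value of a concatenation. [folklore] -/
theorem evalL_append (L₁ L₂ : List (ℤ × (Fin n → ℕ))) :
    ((L₁ ++ L₂).map fun t : ℤ × (Fin n → ℕ) =>
        (monomial (Finsupp.equivFunOnFinite.symm t.2) ((t.1 : ℤ) : K) : MvPolynomial (Fin n) K)).sum =
      (L₁.map fun t : ℤ × (Fin n → ℕ) =>
        (monomial (Finsupp.equivFunOnFinite.symm t.2) ((t.1 : ℤ) : K) : MvPolynomial (Fin n) K)).sum +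
      (L₂.map fun t : ℤ × (Fin n → ℕ) =>
        (monomial (Finsupp.equivFunOnFinite.symm t.2) ((t.1 : ℤ) : K) : MvPolynomial (Fin n) K)).sum := by
  rw [List.map_append, List.sum_append]

/-- Value of a scalar-monomial multiple: `(c·Y^v) · value(L) = value(L shifted)`. [folklore] -/
theorem monomial_mul_evalL (c : ℤ) (v : Fin n → ℕ) (L : List (ℤ × (Fin n → ℕ))) :
    (monomial (Finsupp.equivFunOnFinite.symm v) ((c : ℤ) : K) : MvPolynomial (Fin n) K) *
        (L.map fun t : ℤ × (Fin n → ℕ) =>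
          (monomial (Finsupp.equivFunOnFinite.symm t.2) ((t.1 : ℤ) : K) : MvPolynomial (Fin n) K)).sum =
      ((L.map fun t : ℤ × (Fin n → ℕ) => (c * t.1, v + t.2)).map fun t : ℤ × (Fin n → ℕ) =>
          (monomial (Finsupp.equivFunOnFinite.symm t.2) ((t.1 : ℤ) : K) : MvPolynomial (Fin n) K)).sum := by
  induction L with
  | nil => simp
  | cons t L ih =>
    rw [List.map_cons, List.sum_cons, mul_add, ih, List.map_cons, List.map_cons, List.sum_cons, monomial_mul, Q6CNKit.symm_add,
      Int.cast_mul]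

/-- **Value of a product list**: `value(L₁ ⋆ L₂) = value L₁ · value L₂` for
`L₁ ⋆ L₂ := L₁.flatMap (fun s => L₂.map (fun t => (s.1·t.1, s.2+t.2)))`. [folklore] -/
theorem evalL_mul (L₁ L₂ : List (ℤ × (Fin n → ℕ))) :
    ((L₁.flatMap fun s : ℤ × (Fin n → ℕ) => L₂.map fun t : ℤ × (Fin n → ℕ) => (s.1 * t.1, s.2 + t.2)).map
        fun t : ℤ × (Fin n → ℕ) =>
          (monomial (Finsupp.equivFunOnFinite.symm t.2) ((t.1 : ℤ) : K) : MvPolynomial (Fin n) K)).sum =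
      (L₁.map fun t : ℤ × (Fin n → ℕ) =>
          (monomial (Finsupp.equivFunOnFinite.symm t.2) ((t.1 : ℤ) : K) : MvPolynomial (Fin n) K)).sum *
      (L₂.map fun t : ℤ × (Fin n → ℕ) =>
          (monomial (Finsupp.equivFunOnFinite.symm t.2) ((t.1 : ℤ) : K) : MvPolynomial (Fin n) K)).sum := by
  induction L₁ with
  | nil => simp
  | cons s L₁ ih =>
    rw [List.flatMap_cons, List.map_append, List.sum_append, ih, List.map_cons, List.sum_cons, add_mul,
      monomial_mul_evalL]

/-- Value of the negated list. [folklore] -/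
theorem evalL_neg (L : List (ℤ × (Fin n → ℕ))) :
    ((L.map fun t : ℤ × (Fin n → ℕ) => (-t.1, t.2)).map fun t : ℤ × (Fin n → ℕ) =>
        (monomial (Finsupp.equivFunOnFinite.symm t.2) ((t.1 : ℤ) : K) : MvPolynomial (Fin n) K)).sum =
      -(L.map fun t : ℤ × (Fin n → ℕ) =>
        (monomial (Finsupp.equivFunOnFinite.symm t.2) ((t.1 : ℤ) : K) : MvPolynomial (Fin n) K)).sum := by
  induction L with
  | nil => simp
  | cons t L ih =>
    rw [List.map_cons, List.map_cons, List.sum_cons, ih, List.map_cons, List.sum_cons, neg_add, Int.cast_neg, map_neg]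

/-! ## §2 Partial derivatives and restriction to a stratum -/

/-- **`∂/∂Y_j` of a term list**, termwise: `(c, v) ↦ (c · v j, v − e_j)`. [folklore] -/
theorem pderiv_evalL (j : Fin n) (L : List (ℤ × (Fin n → ℕ))) :
    pderiv j ((L.map fun t : ℤ × (Fin n → ℕ) =>
        (monomial (Finsupp.equivFunOnFinite.symm t.2) ((t.1 : ℤ) : K) : MvPolynomial (Fin n) K)).sum) =
      ((L.map fun t : ℤ × (Fin n → ℕ) => (t.1 * (t.2 j : ℤ), Function.update t.2 j (t.2 j - 1))).map
        fun t : ℤ × (Fin n → ℕ) =>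
          (monomial (Finsupp.equivFunOnFinite.symm t.2) ((t.1 : ℤ) : K) : MvPolynomial (Fin n) K)).sum := by
  classical
  induction L with
  | nil => simp
  | cons t L ih =>
    rw [List.map_cons, List.sum_cons, map_add, ih, List.map_cons, List.map_cons, List.sum_cons, pderiv_monomial]
    congr 1
    have hexp : (Finsupp.equivFunOnFinite.symm t.2 : Fin n →₀ ℕ) - Finsupp.single j 1 =
        Finsupp.equivFunOnFinite.symm (Function.update t.2 j (t.2 j - 1)) := by
      ext i
      rw [Finsupp.tsub_apply, Finsupp.coe_equivFunOnFinite_symm, Finsupp.coe_equivFunOnFinite_symm,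
        Finsupp.single_apply]
      by_cases h : j = i
      · subst h; rw [if_pos rfl, Function.update_self]
      · rw [if_neg h, Function.update_of_ne (Ne.symm h), tsub_zero]
    rw [hexp, Finsupp.coe_equivFunOnFinite_symm, Int.cast_mul, Int.cast_natCast]

/-- **Restriction to the stratum `Y_S = 0` of a term list**: keep the terms whose exponent vanishes on `S`. [folklore] -/
theorem substZero_evalL (S : Finset (Fin n)) (L : List (ℤ × (Fin n → ℕ))) :
    aeval (fun i : Fin n => if i ∈ S then (0 : MvPolynomial (Fin n) K) else X i)
        ((L.map fun t : ℤ × (Fin n → ℕ) =>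
          (monomial (Finsupp.equivFunOnFinite.symm t.2) ((t.1 : ℤ) : K) : MvPolynomial (Fin n) K)).sum) =
      ((L.filter fun t : ℤ × (Fin n → ℕ) => ∀ i ∈ S, t.2 i = 0).map fun t : ℤ × (Fin n → ℕ) =>
          (monomial (Finsupp.equivFunOnFinite.symm t.2) ((t.1 : ℤ) : K) : MvPolynomial (Fin n) K)).sum := by
  classical
  induction L with
  | nil => simp
  | cons t L ih =>
    rw [List.map_cons, List.sum_cons, map_add, ih, ToricChartFedder.substZero_monomial, List.filter_cons]
    by_cases h : ∀ i ∈ S, t.2 i = 0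
    · have h' : ∀ i ∈ S, (Finsupp.equivFunOnFinite.symm t.2 : Fin n →₀ ℕ) i = 0 := fun i hi => by
        rw [Finsupp.coe_equivFunOnFinite_symm]; exact h i hi
      rw [if_pos h', decide_eq_true h, if_pos rfl, List.map_cons, List.sum_cons]
    · have h' : ¬ ∀ i ∈ S, (Finsupp.equivFunOnFinite.symm t.2 : Fin n →₀ ℕ) i = 0 := fun h'' => h fun i hi => by
        have := h'' i hi; rwa [Finsupp.coe_equivFunOnFinite_symm] at this
      rw [if_neg h', decide_eq_false h, zero_add]
      simp

/-! ## §3 Coefficients and the congruence criterion -/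

/-- **Coefficient of a term list** at the exponent `v`: the sum of the (cast) integer coefficients of the terms with exponent `v`.
[folklore] -/
theorem coeff_evalL (v : Fin n → ℕ) (L : List (ℤ × (Fin n → ℕ))) :
    coeff (Finsupp.equivFunOnFinite.symm v)
        ((L.map fun t : ℤ × (Fin n → ℕ) =>
          (monomial (Finsupp.equivFunOnFinite.symm t.2) ((t.1 : ℤ) : K) : MvPolynomial (Fin n) K)).sum) =
      ((((L.filter fun t : ℤ × (Fin n → ℕ) => t.2 = v).map fun t : ℤ × (Fin n → ℕ) => t.1).sum : ℤ) : K) := by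
  classical
  induction L with
  | nil => simp
  | cons t L ih =>
    rw [List.map_cons, List.sum_cons, coeff_add, ih, coeff_monomial, List.filter_cons]
    by_cases h : t.2 = v
    · rw [if_pos (by rw [h]), decide_eq_true h, if_pos rfl, List.map_cons, List.sum_cons, Int.cast_add]
    · have h' : (Finsupp.equivFunOnFinite.symm t.2 : Fin n →₀ ℕ) ≠ Finsupp.equivFunOnFinite.symm v :=
        fun h'' => h (Finsupp.equivFunOnFinite.symm.injective h'')
      rw [if_neg h', decide_eq_false h, zero_add]
      simp

/-- **THE CONGRUENCE CRITERION.** Over a ring `K` of characteristic `p`, two term lists whose integer coefficient sums are congruent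
modulo `p` at every exponent occurring in either list have the same value. (All other coefficients are `0` on both sides.) The
hypothesis is `decide`-able on literal data. [folklore] -/
theorem evalL_eq_of_coeff_congr (p : ℕ) [CharP K p] (L₁ L₂ : List (ℤ × (Fin n → ℕ)))
    (h : ∀ v ∈ L₁.map (fun t : ℤ × (Fin n → ℕ) => t.2) ++ L₂.map (fun t : ℤ × (Fin n → ℕ) => t.2),
      (p : ℤ) ∣ ((L₁.filter fun t : ℤ × (Fin n → ℕ) => t.2 = v).map (fun t : ℤ × (Fin n → ℕ) => t.1)).sum -
        ((L₂.filter fun t : ℤ × (Fin n → ℕ) => t.2 = v).map (fun t : ℤ × (Fin n → ℕ) => t.1)).sum) :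
    (L₁.map fun t : ℤ × (Fin n → ℕ) =>
        (monomial (Finsupp.equivFunOnFinite.symm t.2) ((t.1 : ℤ) : K) : MvPolynomial (Fin n) K)).sum =
      (L₂.map fun t : ℤ × (Fin n → ℕ) =>
        (monomial (Finsupp.equivFunOnFinite.symm t.2) ((t.1 : ℤ) : K) : MvPolynomial (Fin n) K)).sum := by
  classical
  refine MvPolynomial.ext _ _ fun m => ?_
  have hm : (Finsupp.equivFunOnFinite.symm (⇑m) : Fin n →₀ ℕ) = m := by ext i; simp
  rw [← hm, coeff_evalL, coeff_evalL]
  by_cases hv : (⇑m) ∈ L₁.map (fun t : ℤ × (Fin n → ℕ) => t.2) ++ L₂.map (fun t : ℤ × (Fin n → ℕ) => t.2)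
  · obtain ⟨d, hd⟩ := h _ hv
    rw [← sub_eq_zero, ← Int.cast_sub, hd, Int.cast_mul, Int.cast_natCast, CharP.cast_eq_zero, zero_mul]
  · rw [List.mem_append, not_or, List.mem_map, List.mem_map, not_exists, not_exists] at hv
    have h1 : (L₁.filter fun t : ℤ × (Fin n → ℕ) => t.2 = ⇑m) = [] :=
      List.filter_eq_nil_iff.mpr fun t ht heq => hv.1 t ⟨ht, of_decide_eq_true heq⟩
    have h2 : (L₂.filter fun t : ℤ × (Fin n → ℕ) => t.2 = ⇑m) = [] :=
      List.filter_eq_nil_iff.mpr fun t ht heq => hv.2 t ⟨ht, of_decide_eq_true heq⟩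
    rw [h1, h2]

/-! ## §4 The chart map on a term list -/

/-- **`θ_V` on a term list, factored**: if termwise `V·v = d + v'` (with equal coefficients) then
`θ_V (value L) = Y^d · value L'`. [folklore] -/
theorem theta_evalL (V : Matrix (Fin n) (Fin n) ℕ) (d : Fin n → ℕ) :
    ∀ (L L' : List (ℤ × (Fin n → ℕ))),
    List.Forall₂ (fun t t' : ℤ × (Fin n → ℕ) => t.1 = t'.1 ∧ V.mulVec t.2 = d + t'.2) L L' →
    aeval (fun j : Fin n => ∏ i : Fin n, (X i : MvPolynomial (Fin n) K) ^ V i j)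
        ((L.map fun t : ℤ × (Fin n → ℕ) =>
          (monomial (Finsupp.equivFunOnFinite.symm t.2) ((t.1 : ℤ) : K) : MvPolynomial (Fin n) K)).sum) =
      monomial (Finsupp.equivFunOnFinite.symm d) 1 *
        ((L'.map fun t : ℤ × (Fin n → ℕ) =>
          (monomial (Finsupp.equivFunOnFinite.symm t.2) ((t.1 : ℤ) : K) : MvPolynomial (Fin n) K)).sum) := by
  intro L L' h
  induction h with
  | nil => simp
  | @cons t t' L L' ht _ ih =>
    rw [List.map_cons, List.sum_cons, map_add, ih, List.map_cons, List.sum_cons, mul_add,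
      ToricChartFedder.theta_monomial, monomial_mul, one_mul, Finsupp.coe_equivFunOnFinite_symm, ht.2, Q6CNKit.symm_add, ht.1]

end Summit.ResolutionOfSingularities.ResolutionOfSingularities.Theorems.FInjectiveMacaulayfication.CIPolyKit

end
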